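import Mathlib
import Literature.MathematicalPhysics.QuantumLattice.BoundedWilsonFlowLift
import Literature.MathematicalPhysics.QuantumLattice.TorusWilsonFlowExistence
import Literature.MathematicalPhysics.QuantumFieldTheory.WilsonFlow

/-!
# The Wilson action decreases along Lüscher's flow — for every gauge group `H ⊆ U(N)`

Helper file for item stmt-QuantumFields-14706 (`FlowLineStateSpace.FlowedEnergyMeanBound`, route
FlowLineStateSpace, YangMills sub-problem). The tree proves the monotonicity of the Wilson action
along the Wilson flow for `SU(n)` in its defining representation
(`QuantumFieldTheory.WilsonFlow.antitone_wilsonAction_wilsonFlow`); the route items run the flow of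
`ρ(U)` inside an arbitrary closed subgroup `H = range ρ ⊆ U(N)` (the tree's matrix-level flow
`IsWilsonFlowLine H V Φ`, `Literature/MathematicalPhysics/QuantumLattice/LatticeWilsonFlow.lean`).
Here we prove, for every `H ⊆ U(N)`, every finite lattice `Fin d → R` (`R` a finite additive
commutative group with `1`, e.g. the discrete torus `ZMod S`) and every flow line `Φ` of (1.4)
through unitary link matrices,

  `t ↦ Σ_x energyDensity (Φ t) x` is antitone  (`antitone_sum_energyDensity`)

— Lüscher, JHEP 08 (2010) 071, §1 p. 2: "the action S_w(V_t) is a monotonically decreasing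
function of t" (the flow is the gradient flow of the action). Proof: `d/dt Re tr U_p(Φ_t)` is minus
the sum over the four links `e` of `p` of `Re tr(π_𝔥 Ω_e · loop from e)` (the tree's trace algebra
`WilsonFlow.re_trace_plaquette_deriv`); regrouping the plaquette sum link by link gives
`d/dt Σ_x E(x) = 2 Σ_e Re tr(π_𝔥(Ω_e) Ω_e)`, and `Re tr(π_𝔥(W) W) = -‖π_𝔥 W‖² ≤ 0` because `π_𝔥` is
the Frobenius-orthogonal projection onto a space of skew-Hermitian matrices (`H ⊆ U(N)`).
Definition-free; no statement about Yang–Mills is proved here.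
-/

noncomputable section

open scoped Matrix.Norms.Frobenius Topology
open Matrix Finset
open Literature.MathematicalPhysics.QuantumLattice

namespace Summit.QuantumFields.YangMills.Theorems.FlowLineStateSpaceFlowMonotone

variable {N : ℕ}

/-! ### The gradient-flow sign -/

/-- For `H ⊆ U(N)`: `Re tr(π_𝔥(W) · W) = -‖π_𝔥 W‖² ≤ 0`. -/
theorem re_trace_lieProjection_mul_nonpos {H : Set (Matrix (Fin N) (Fin N) ℂ)}
    (hH : ∀ A ∈ H, A ∈ Matrix.unitaryGroup (Fin N) ℂ) (W : Matrix (Fin N) (Fin N) ℂ) :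
    (lieProjection H W * W).trace.re ≤ 0 := by
  letI : InnerProductSpace ℝ (Matrix (Fin N) (Fin N) ℂ) := frobeniusInnerProductSpace
  set X := lieProjection H W with hXdef
  have hX : Xᴴ = -X := conjTranspose_lieProjection hH W
  have h1 : (X * W).trace.re = -inner ℝ X W := by
    rw [frobenius_inner_def, hX, Matrix.neg_mul, Matrix.trace_neg, Complex.neg_re, neg_neg]
  have h2 : inner ℝ X W = inner ℝ X X := by
    have h := inner_sub_lieProjection (lieProjection_mem H W) W
    rw [inner_sub_right] at h
    rw [← hXdef] at h
    linarith
  rw [h1, h2]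
  exact neg_nonpos.mpr real_inner_self_nonneg

/-! ### The derivative of one plaquette along a flow line -/

variable {d : ℕ} {R : Type*} [AddCommGroup R] [One R]

/-- The "down" plaquette loop through the link `(x, μ)` in direction `ν`:
`V(x,μ) V(x+μ̂-ν̂,ν)† V(x-ν̂,μ)† V(x-ν̂,ν)` — the second summand of the tree's `plaquetteSum`. -/
theorem plaquetteSum_eq (V : MatrixLinkField d R N) (x : Fin d → R) (μ : Fin d) :
    plaquetteSum V (x, μ) = ∑ ν : Fin d, if ν = μ then 0 else
      (plaquetteMatrix V x μ ν +
        V (x, μ) * (V (x + Pi.single μ 1 - Pi.single ν 1, ν))ᴴ * (V (x - Pi.single ν 1, μ))ᴴ *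
          V (x - Pi.single ν 1, ν)) := by
  simp only [plaquetteSum, plaquetteMatrix]

/-- **Derivative of `Re tr` of one plaquette along a flow line**: minus the sum over its four
links of `Re tr(π_𝔥 Ω_e · loop starting at e)`. -/
theorem hasDerivAt_re_trace_plaquetteMatrix {H : Set (Matrix (Fin N) (Fin N) ℂ)}
    {V : MatrixLinkField d R N} {Φ : ℝ → MatrixLinkField d R N} (h : IsWilsonFlowLine H V Φ)
    (t : ℝ) (x : Fin d → R) (μ ν : Fin d) :
    HasDerivAt (fun s => (plaquetteMatrix (Φ s) x μ ν).trace.re)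
      (-((lieProjection H (plaquetteSum (Φ t) (x, μ)) *
            (Φ t (x, μ) * Φ t (x + Pi.single μ 1, ν) * (Φ t (x + Pi.single ν 1, μ))ᴴ *
              (Φ t (x, ν))ᴴ)).trace.re +
        (lieProjection H (plaquetteSum (Φ t) (x + Pi.single μ 1, ν)) *
            (Φ t (x + Pi.single μ 1, ν) * (Φ t (x + Pi.single ν 1, μ))ᴴ * (Φ t (x, ν))ᴴ *
              Φ t (x, μ))).trace.re +
        (lieProjection H (plaquetteSum (Φ t) (x + Pi.single ν 1, μ)) *
            (Φ t (x + Pi.single ν 1, μ) * (Φ t (x + Pi.single μ 1, ν))ᴴ * (Φ t (x, μ))ᴴ *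
              Φ t (x, ν))).trace.re +
        (lieProjection H (plaquetteSum (Φ t) (x, ν)) *
            (Φ t (x, ν) * Φ t (x + Pi.single ν 1, μ) * (Φ t (x + Pi.single μ 1, ν))ᴴ *
              (Φ t (x, μ))ᴴ)).trace.re)) t := by
  have hW : ∀ e : (Fin d → R) × Fin d, HasDerivAt (fun s => Φ s e)
      (-lieProjection H (plaquetteSum (Φ t) e) * Φ t e) t := fun e => by
    have := h.hasDerivAt t e
    simpa only [wilsonFlowField, wilsonFlowGenerator] using this
  have hprod := (((hW (x, μ)).fun_mul (hW (x + Pi.single μ 1, ν))).fun_mul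
    (hW (x + Pi.single ν 1, μ)).star).fun_mul (hW (x, ν)).star
  have hfun : (fun s => plaquetteMatrix (Φ s) x μ ν) =
      fun s => Φ s (x, μ) * Φ s (x + Pi.single μ 1, ν) * star (Φ s (x + Pi.single ν 1, μ)) *
        star (Φ s (x, ν)) := by
    funext s; simp only [plaquetteMatrix, Matrix.star_eq_conjTranspose]
  have htr := Complex.reCLM.hasFDerivAt.comp_hasDerivAt t
    (Literature.MathematicalPhysics.QuantumFieldTheory.WilsonFlow.traceCLM.hasFDerivAt.comp_hasDerivAt
      t hprod)
  rw [← hfun] at htr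
  refine htr.congr_deriv ?_
  show (_ : Matrix (Fin N) (Fin N) ℂ).trace.re = _
  rw [Literature.MathematicalPhysics.QuantumFieldTheory.WilsonFlow.re_trace_plaquette_deriv]

/-! ### Regrouping the plaquette sum link by link -/

/-- Symmetrisation over ordered pairs: `Σ_{μ<ν} (h μ ν + h ν μ) = Σ_{μ ≠ ν} h μ ν`. -/
theorem sum_lt_symm_eq_sum_ne (h : Fin d → Fin d → ℝ) :
    ∑ μ : Fin d, ∑ ν : Fin d, (if μ < ν then h μ ν + h ν μ else 0) =
      ∑ μ : Fin d, ∑ ν : Fin d, (if ν = μ then 0 else h μ ν) := by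
  have h1 : ∑ μ : Fin d, ∑ ν : Fin d, (if μ < ν then h μ ν + h ν μ else 0) =
      ∑ μ : Fin d, ∑ ν : Fin d, (if μ < ν then h μ ν else 0) +
        ∑ μ : Fin d, ∑ ν : Fin d, (if μ < ν then h ν μ else 0) := by
    rw [← sum_add_distrib]
    refine sum_congr rfl fun μ _ => ?_
    rw [← sum_add_distrib]
    refine sum_congr rfl fun ν _ => ?_
    split_ifs <;> simp
  have h2 : ∑ μ : Fin d, ∑ ν : Fin d, (if μ < ν then h ν μ else 0) =
      ∑ μ : Fin d, ∑ ν : Fin d, (if ν < μ then h μ ν else 0) := by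
    rw [sum_comm]
  have h3 : ∑ μ : Fin d, ∑ ν : Fin d, (if ν = μ then 0 else h μ ν) =
      ∑ μ : Fin d, ∑ ν : Fin d, (if μ < ν then h μ ν else 0) +
        ∑ μ : Fin d, ∑ ν : Fin d, (if ν < μ then h μ ν else 0) := by
    rw [← sum_add_distrib]
    refine sum_congr rfl fun μ _ => ?_
    rw [← sum_add_distrib]
    refine sum_congr rfl fun ν _ => ?_
    rcases lt_trichotomy μ ν with hlt | heq | hgt
    · simp [hlt, hlt.ne', not_lt.mpr hlt.le]
    · subst heq; simp
    · simp [hgt, hgt.ne, not_lt.mpr hgt.le]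
  rw [h1, h2, h3]

variable [Fintype R]

/-- **Regrouping.** Summing, over all plaquettes `(x, μ < ν)`, the four link terms of the plaquette
derivative gives the sum over links `e` of `Re tr(X_e · Ω_e)`, for ANY link-indexed matrices `X`. -/
theorem sum_plaquette_link_terms (V : MatrixLinkField d R N)
    (X : (Fin d → R) × Fin d → Matrix (Fin N) (Fin N) ℂ) :
    ∑ x : Fin d → R, ∑ μ : Fin d, ∑ ν : Fin d, (if μ < ν then
      ((X (x, μ) * (V (x, μ) * V (x + Pi.single μ 1, ν) * (V (x + Pi.single ν 1, μ))ᴴ *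
          (V (x, ν))ᴴ)).trace.re +
        (X (x + Pi.single μ 1, ν) * (V (x + Pi.single μ 1, ν) * (V (x + Pi.single ν 1, μ))ᴴ *
          (V (x, ν))ᴴ * V (x, μ))).trace.re +
        (X (x + Pi.single ν 1, μ) * (V (x + Pi.single ν 1, μ) * (V (x + Pi.single μ 1, ν))ᴴ *
          (V (x, μ))ᴴ * V (x, ν))).trace.re +
        (X (x, ν) * (V (x, ν) * V (x + Pi.single ν 1, μ) * (V (x + Pi.single μ 1, ν))ᴴ *
          (V (x, μ))ᴴ)).trace.re) else 0) =
      ∑ x : Fin d → R, ∑ μ : Fin d, (X (x, μ) * plaquetteSum V (x, μ)).trace.re := by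
  -- the two kinds of link terms
  set U : (Fin d → R) → Fin d → Fin d → ℝ := fun x μ ν =>
    (X (x, μ) * (V (x, μ) * V (x + Pi.single μ 1, ν) * (V (x + Pi.single ν 1, μ))ᴴ *
      (V (x, ν))ᴴ)).trace.re with hU
  set Dn : (Fin d → R) → Fin d → Fin d → ℝ := fun x μ ν =>
    (X (x, μ) * (V (x, μ) * (V (x + Pi.single μ 1 - Pi.single ν 1, ν))ᴴ *
      (V (x - Pi.single ν 1, μ))ᴴ * V (x - Pi.single ν 1, ν))).trace.re with hDn
  -- identify the four summands
  have hid : ∀ x μ ν, (if μ < ν then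
      ((X (x, μ) * (V (x, μ) * V (x + Pi.single μ 1, ν) * (V (x + Pi.single ν 1, μ))ᴴ *
          (V (x, ν))ᴴ)).trace.re +
        (X (x + Pi.single μ 1, ν) * (V (x + Pi.single μ 1, ν) * (V (x + Pi.single ν 1, μ))ᴴ *
          (V (x, ν))ᴴ * V (x, μ))).trace.re +
        (X (x + Pi.single ν 1, μ) * (V (x + Pi.single ν 1, μ) * (V (x + Pi.single μ 1, ν))ᴴ *
          (V (x, μ))ᴴ * V (x, ν))).trace.re +
        (X (x, ν) * (V (x, ν) * V (x + Pi.single ν 1, μ) * (V (x + Pi.single μ 1, ν))ᴴ *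
          (V (x, μ))ᴴ)).trace.re) else 0) =
      (if μ < ν then U x μ ν + U x ν μ else 0) +
        ((if μ < ν then Dn (x + Pi.single μ 1) ν μ else 0) +
          (if μ < ν then Dn (x + Pi.single ν 1) μ ν else 0)) := by
    intro x μ ν
    have e1 : x + Pi.single μ 1 + Pi.single ν 1 - Pi.single μ 1 = x + Pi.single ν 1 := by abel
    have e2 : x + Pi.single μ 1 - Pi.single μ 1 = x := by abel
    have e3 : x + Pi.single ν 1 + Pi.single μ 1 - Pi.single ν 1 = x + Pi.single μ 1 := by abel
    have e4 : x + Pi.single ν 1 - Pi.single ν 1 = x := by abel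
    split_ifs with hμν
    · simp only [hU, hDn, e1, e2, e3, e4]; ring
    · simp
  simp_rw [hid]
  rw [show (∑ x : Fin d → R, ∑ μ : Fin d, ∑ ν : Fin d,
      ((if μ < ν then U x μ ν + U x ν μ else 0) +
        ((if μ < ν then Dn (x + Pi.single μ 1) ν μ else 0) +
          (if μ < ν then Dn (x + Pi.single ν 1) μ ν else 0)))) =
      ∑ x : Fin d → R, ∑ μ : Fin d, ∑ ν : Fin d, (if μ < ν then U x μ ν + U x ν μ else 0) +
      (∑ x : Fin d → R, ∑ μ : Fin d, ∑ ν : Fin d, (if μ < ν then Dn (x + Pi.single μ 1) ν μ else 0) +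
        ∑ x : Fin d → R, ∑ μ : Fin d, ∑ ν : Fin d,
          (if μ < ν then Dn (x + Pi.single ν 1) μ ν else 0)) by
    simp only [sum_add_distrib]]
  -- shift the base point in the two `Dn` sums
  have hshift : ∀ (μ : Fin d) (f : (Fin d → R) → ℝ),
      ∑ x : Fin d → R, f (x + Pi.single μ 1) = ∑ x : Fin d → R, f x := fun μ f =>
    Fintype.sum_equiv (Equiv.addRight (Pi.single μ 1)) _ _ fun x => rfl
  have hD2 : ∑ x : Fin d → R, ∑ μ : Fin d, ∑ ν : Fin d,
      (if μ < ν then Dn (x + Pi.single μ 1) ν μ else 0) =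
      ∑ x : Fin d → R, ∑ μ : Fin d, ∑ ν : Fin d, (if μ < ν then Dn x ν μ else 0) := by
    rw [sum_comm]
    conv_rhs => rw [sum_comm]
    refine sum_congr rfl fun μ _ => ?_
    rw [sum_comm]
    conv_rhs => rw [sum_comm]
    refine sum_congr rfl fun ν _ => ?_
    split_ifs
    · exact hshift μ (fun x => Dn x ν μ)
    · simp
  have hD3 : ∑ x : Fin d → R, ∑ μ : Fin d, ∑ ν : Fin d,
      (if μ < ν then Dn (x + Pi.single ν 1) μ ν else 0) =
      ∑ x : Fin d → R, ∑ μ : Fin d, ∑ ν : Fin d, (if μ < ν then Dn x μ ν else 0) := by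
    rw [sum_comm]
    conv_rhs => rw [sum_comm]
    refine sum_congr rfl fun μ _ => ?_
    rw [sum_comm]
    conv_rhs => rw [sum_comm]
    refine sum_congr rfl fun ν _ => ?_
    split_ifs
    · exact hshift ν (fun x => Dn x μ ν)
    · simp
  rw [hD2, hD3]
  -- symmetrise
  have hDsym : ∑ x : Fin d → R, ∑ μ : Fin d, ∑ ν : Fin d, (if μ < ν then Dn x ν μ else 0) +
      ∑ x : Fin d → R, ∑ μ : Fin d, ∑ ν : Fin d, (if μ < ν then Dn x μ ν else 0) =
      ∑ x : Fin d → R, ∑ μ : Fin d, ∑ ν : Fin d, (if ν = μ then 0 else Dn x μ ν) := by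
    rw [← sum_add_distrib]
    refine sum_congr rfl fun x _ => ?_
    rw [← sum_lt_symm_eq_sum_ne (Dn x), ← sum_add_distrib]
    refine sum_congr rfl fun μ _ => ?_
    rw [← sum_add_distrib]
    refine sum_congr rfl fun ν _ => ?_
    split_ifs <;> ring
  have hUsym : ∑ x : Fin d → R, ∑ μ : Fin d, ∑ ν : Fin d, (if μ < ν then U x μ ν + U x ν μ else 0) =
      ∑ x : Fin d → R, ∑ μ : Fin d, ∑ ν : Fin d, (if ν = μ then 0 else U x μ ν) :=
    sum_congr rfl fun x _ => sum_lt_symm_eq_sum_ne (U x)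
  rw [hDsym, hUsym, ← sum_add_distrib]
  refine sum_congr rfl fun x _ => ?_
  rw [← sum_add_distrib]
  refine sum_congr rfl fun μ _ => ?_
  rw [plaquetteSum_eq, Matrix.mul_sum, Matrix.trace_sum, Complex.re_sum, ← sum_add_distrib]
  refine sum_congr rfl fun ν _ => ?_
  split_ifs
  · simp
  · simp only [hU, hDn, plaquetteMatrix, Matrix.mul_add, Matrix.trace_add, Complex.add_re]

/-! ### The action decreases along the flow -/

/-- **Derivative of the total action density along a flow line**:
`d/dt Σ_x E(Φ_t)(x) = 2 Σ_{(x,μ)} Re tr(π_𝔥(Ω_{(x,μ)}(Φ_t)) · Ω_{(x,μ)}(Φ_t))`. -/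
theorem hasDerivAt_sum_energyDensity {H : Set (Matrix (Fin N) (Fin N) ℂ)}
    {V : MatrixLinkField d R N} {Φ : ℝ → MatrixLinkField d R N} (h : IsWilsonFlowLine H V Φ)
    (t : ℝ) :
    HasDerivAt (fun s => ∑ x : Fin d → R, energyDensity (Φ s) x)
      (2 * ∑ x : Fin d → R, ∑ μ : Fin d,
        (lieProjection H (plaquetteSum (Φ t) (x, μ)) * plaquetteSum (Φ t) (x, μ)).trace.re) t := by
  set X : (Fin d → R) × Fin d → Matrix (Fin N) (Fin N) ℂ := fun e =>
    lieProjection H (plaquetteSum (Φ t) e) with hX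
  -- each summand `if μ < ν then N - Re tr P else 0`
  have hterm : ∀ (x : Fin d → R) (μ ν : Fin d),
      HasDerivAt (fun s => (if μ < ν then ((N : ℝ) - (plaquetteMatrix (Φ s) x μ ν).trace.re) else 0 : ℝ))
        (if μ < ν then
          ((X (x, μ) * (Φ t (x, μ) * Φ t (x + Pi.single μ 1, ν) * (Φ t (x + Pi.single ν 1, μ))ᴴ *
              (Φ t (x, ν))ᴴ)).trace.re +
            (X (x + Pi.single μ 1, ν) * (Φ t (x + Pi.single μ 1, ν) *
              (Φ t (x + Pi.single ν 1, μ))ᴴ * (Φ t (x, ν))ᴴ * Φ t (x, μ))).trace.re +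
            (X (x + Pi.single ν 1, μ) * (Φ t (x + Pi.single ν 1, μ) *
              (Φ t (x + Pi.single μ 1, ν))ᴴ * (Φ t (x, μ))ᴴ * Φ t (x, ν))).trace.re +
            (X (x, ν) * (Φ t (x, ν) * Φ t (x + Pi.single ν 1, μ) * (Φ t (x + Pi.single μ 1, ν))ᴴ *
              (Φ t (x, μ))ᴴ)).trace.re) else 0) t := by
    intro x μ ν
    by_cases hμν : μ < ν
    · simp only [if_pos hμν]
      have h1 := (hasDerivAt_re_trace_plaquetteMatrix h t x μ ν).const_sub (N : ℝ)
      simp only [neg_neg] at h1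
      exact h1
    · simp only [if_neg hμν]
      exact hasDerivAt_const t 0
  have hx : ∀ x : Fin d → R, HasDerivAt (fun s => energyDensity (Φ s) x)
      (2 * ∑ μ : Fin d, ∑ ν : Fin d, (if μ < ν then
          ((X (x, μ) * (Φ t (x, μ) * Φ t (x + Pi.single μ 1, ν) * (Φ t (x + Pi.single ν 1, μ))ᴴ *
              (Φ t (x, ν))ᴴ)).trace.re +
            (X (x + Pi.single μ 1, ν) * (Φ t (x + Pi.single μ 1, ν) *
              (Φ t (x + Pi.single ν 1, μ))ᴴ * (Φ t (x, ν))ᴴ * Φ t (x, μ))).trace.re +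
            (X (x + Pi.single ν 1, μ) * (Φ t (x + Pi.single ν 1, μ) *
              (Φ t (x + Pi.single μ 1, ν))ᴴ * (Φ t (x, μ))ᴴ * Φ t (x, ν))).trace.re +
            (X (x, ν) * (Φ t (x, ν) * Φ t (x + Pi.single ν 1, μ) * (Φ t (x + Pi.single μ 1, ν))ᴴ *
              (Φ t (x, μ))ᴴ)).trace.re) else 0)) t := by
    intro x
    have hs := HasDerivAt.fun_sum (u := (Finset.univ : Finset (Fin d))) fun μ _ =>
      HasDerivAt.fun_sum (u := (Finset.univ : Finset (Fin d))) fun ν _ => hterm x μ ν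
    have h2 := hs.const_mul (2 : ℝ)
    simp only [energyDensity]
    exact h2
  have hall := HasDerivAt.fun_sum (u := (Finset.univ : Finset (Fin d → R))) fun x _ => hx x
  refine hall.congr_deriv ?_
  rw [← mul_sum, sum_plaquette_link_terms (Φ t) X]

/-- **The Wilson action decreases along Lüscher's flow, for every `H ⊆ U(N)`** (Lüscher 2010 §1):
along any flow line `Φ` of (1.4) on a finite lattice, `t ↦ Σ_x E(Φ_t)(x)` is antitone. -/
theorem antitone_sum_energyDensity {H : Set (Matrix (Fin N) (Fin N) ℂ)}
    (hH : ∀ A ∈ H, A ∈ Matrix.unitaryGroup (Fin N) ℂ)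
    {V : MatrixLinkField d R N} {Φ : ℝ → MatrixLinkField d R N} (h : IsWilsonFlowLine H V Φ) :
    Antitone fun s => ∑ x : Fin d → R, energyDensity (Φ s) x := by
  refine antitone_of_deriv_nonpos (fun t => (hasDerivAt_sum_energyDensity h t).differentiableAt)
    fun t => ?_
  rw [(hasDerivAt_sum_energyDensity h t).deriv]
  refine mul_nonpos_of_nonneg_of_nonpos (by norm_num) (sum_nonpos fun x _ => sum_nonpos fun μ _ => ?_)
  exact re_trace_lieProjection_mul_nonpos hH _

/-- Corollary for `s ≤ t`: `Σ_x E(Φ_t)(x) ≤ Σ_x E(Φ_s)(x)`. -/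
theorem sum_energyDensity_le_of_le {H : Set (Matrix (Fin N) (Fin N) ℂ)}
    (hH : ∀ A ∈ H, A ∈ Matrix.unitaryGroup (Fin N) ℂ)
    {V : MatrixLinkField d R N} {Φ : ℝ → MatrixLinkField d R N} (h : IsWilsonFlowLine H V Φ)
    {s t : ℝ} (hst : s ≤ t) :
    ∑ x : Fin d → R, energyDensity (Φ t) x ≤ ∑ x : Fin d → R, energyDensity (Φ s) x :=
  antitone_sum_energyDensity hH h hst

end Summit.QuantumFields.YangMills.Theorems.FlowLineStateSpaceFlowMonotone

end
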